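import Summits.ValiantsHypothesis.ValiantsHypothesis.Theorems.DefinabilityGapDegreeRoadOne
import HarnessLib

/-!
# DefinabilityGap — the degree road beyond `q`:  `t₀(m)/q(m) → ∞`  (every constant multiple of `q`)

Route `route-ValiantsHypothesis-DefinabilityGap` (decomp-valiant, lens 5: hardness–randomness / PIT axis), supporting
`KIPlantedHitting` (stmt-ValiantsHypothesis-23547) and the degree profile behind `KIAnnihilatorCHDefinable`
(stmt-ValiantsHypothesis-23444). Source: decomp-valiant lens-5 g16, NOTE-g16 §3.6 (C2/C3 of Theorem A⁺).

MAIN THEOREMS (qualitative sharpening of `DefinabilityGapDegreeRoadOne`, same elementary inputs with `e^{−5k}` in place of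
`e^{−5}` and the Archimedean property in place of the numeral `20000`):
* `eventually_q_cube_mul_coinBound_lt_one (k)` — for every `k` there is `M` with `q(m)³ · (1 − c^{2kq(m)/m})^m < 1` for all
  `m ≥ M`;
* `eventually_kiPer_hits_degree_le_mul (k) : ∃ M, ∀ m ≥ M`, no nonzero `D` of total degree `≤ k·q(m)`, of any size, annihilates
  `G_m` — i.e. `t₀(m)/q(m) → ∞` (the initial degree of the annihilator ideal of `G_m` is not `O(q(m))`);
* `eventually_mul_q_lt_card_support (k) : ∃ M, ∀ m ≥ M`, every monomial of every annihilator of `G_m` involves `> k·q(m)`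
  variables.
(The paper bound, NOTE-g16 §3.6 C3, is `t₀(m) ≥ (1 − o(1))·(m(m−1)/2)·ln(m/(3 ln q(m)))`, a `Θ(log m)` multiple of `q`; only the
"every constant multiple" form is certified here.)  Rung 0 of the Valiant ladder; `VP ≠ VNP` untouched. 0 sorry.
-/

set_option linter.dupNamespace false

noncomputable section

open MvPolynomial
open Literature.Computability.AlgebraicComplexity Literature.Computability.MetaComplexity
open Summit.ValiantsHypothesis.ValiantsHypothesis.Theorems.DefinabilityGapAffineRung
open Summit.ValiantsHypothesis.ValiantsHypothesis.Theorems.DefinabilityGapAlienExclusion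
open Summit.ValiantsHypothesis.ValiantsHypothesis.Theorems.DefinabilityGapRandomPatterns
open Summit.ValiantsHypothesis.ValiantsHypothesis.Theorems.DefinabilityGapBlockStep
open Summit.ValiantsHypothesis.ValiantsHypothesis.Theorems.DefinabilityGapRefinedPatterns
open Summit.ValiantsHypothesis.ValiantsHypothesis.Theorems.DefinabilityGapDegreeRoadOne

namespace Summit.ValiantsHypothesis.ValiantsHypothesis.Theorems.DefinabilityGapDegreeRoadOmega

variable {m : ℕ}

/-- **Coin bound for `N ≤ 4k(m²+1)` cells**, `m ≥ 11`: `(1 − c^{N/m})^m ≤ exp(−m·e^{−5k})`. [this file] -/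
theorem coinBound_le_exp_mul (hm : 11 ≤ m) (k : ℕ) {N : ℕ} (hN : (N : ℝ) ≤ 4 * k * ((m : ℝ) ^ 2 + 1)) :
    coinBound m N ≤ Real.exp (-((m : ℝ) * Real.exp (-(5 * k)))) := by
  have hm3 : 3 ≤ m := by omega
  have h11 : (11 : ℝ) ≤ m := by exact_mod_cast hm
  have hm0 : (0 : ℝ) < m := by linarith
  have hm2 : (0 : ℝ) < (m : ℝ) - 2 := by linarith
  have hk0 : (0 : ℝ) ≤ k := Nat.cast_nonneg _
  -- the exponent `y = N/m` satisfies `y/(m−2) ≤ 5k`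
  have hy0 : 0 ≤ (N : ℝ) / m := by positivity
  have hbase : 4 * ((m : ℝ) ^ 2 + 1) ≤ 5 * ((m : ℝ) * ((m : ℝ) - 2)) := by nlinarith
  have hy5 : (N : ℝ) / m / ((m : ℝ) - 2) ≤ 5 * k := by
    rw [div_div, div_le_iff₀ (mul_pos hm0 hm2)]
    calc (N : ℝ) ≤ 4 * k * ((m : ℝ) ^ 2 + 1) := hN
      _ = k * (4 * ((m : ℝ) ^ 2 + 1)) := by ring
      _ ≤ k * (5 * ((m : ℝ) * ((m : ℝ) - 2))) := mul_le_mul_of_nonneg_left hbase hk0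
      _ = 5 * k * ((m : ℝ) * ((m : ℝ) - 2)) := by ring
  -- hence `c^y ≥ e^{−5k}`
  have hcy : Real.exp (-(5 * k)) ≤ cbase m ^ ((N : ℝ) / m) := by
    refine le_trans ?_ (exp_neg_le_cbase_rpow hm3 hy0)
    exact Real.exp_le_exp.2 (by linarith)
  have h0 : 0 ≤ 1 - cbase m ^ ((N : ℝ) / m) :=
    sub_nonneg.2 (Real.rpow_le_one (cbase_nonneg hm3) (cbase_le_one hm3) hy0)
  have hstep : 1 - cbase m ^ ((N : ℝ) / m) ≤ Real.exp (-Real.exp (-(5 * k))) := by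
    have := Real.add_one_le_exp (-Real.exp (-(5 * (k : ℝ))))
    linarith
  unfold coinBound
  calc (1 - cbase m ^ ((N : ℝ) / m)) ^ m ≤ Real.exp (-Real.exp (-(5 * k))) ^ m := pow_le_pow_left₀ h0 hstep m
    _ = Real.exp (-((m : ℝ) * Real.exp (-(5 * k)))) := by
        rw [← Real.exp_nat_mul]; congr 1; ring

/-- `64 m⁶ < exp(m·η)` as soon as `m·η⁷ > 64·7!` (via `x⁷/7! ≤ eˣ`). [this file] -/
theorem numeric_lt_exp_of (hm : 1 ≤ m) {η : ℝ} (hη : 0 < η) (hbig : 64 * (Nat.factorial 7 : ℝ) < (m : ℝ) * η ^ 7) :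
    (64 : ℝ) * (m : ℝ) ^ 6 < Real.exp ((m : ℝ) * η) := by
  have hm0 : (0 : ℝ) < m := by exact_mod_cast hm
  have hexp := Real.pow_div_factorial_le_exp (x := (m : ℝ) * η) (by positivity) 7
  refine lt_of_lt_of_le ?_ hexp
  rw [lt_div_iff₀ (by positivity)]
  have h6 : (0 : ℝ) < (m : ℝ) ^ 6 := by positivity
  calc (64 : ℝ) * (m : ℝ) ^ 6 * (Nat.factorial 7 : ℝ) = (64 * (Nat.factorial 7 : ℝ)) * (m : ℝ) ^ 6 := by ring
    _ < ((m : ℝ) * η ^ 7) * (m : ℝ) ^ 6 := mul_lt_mul_of_pos_right hbig h6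
    _ = ((m : ℝ) * η) ^ 7 := by ring

/-- **For every `k`, eventually `q(m)³ · (1 − c^{2kq(m)/m})^m < 1`.** [this file] -/
theorem eventually_q_cube_mul_coinBound_lt_one (k : ℕ) :
    ∃ M : ℕ, ∀ m : ℕ, M ≤ m → (qOf m : ℝ) ^ 3 * coinBound m (2 * (k * qOf m)) < 1 := by
  set η : ℝ := Real.exp (-(5 * k)) with hη
  have hη0 : 0 < η := Real.exp_pos _
  obtain ⟨M₁, hM₁⟩ := exists_nat_gt (64 * (Nat.factorial 7 : ℝ) / η ^ 7)
  refine ⟨max 11 M₁, fun m hm => ?_⟩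
  have hm11 : 11 ≤ m := le_trans (le_max_left _ _) hm
  have hmM : M₁ ≤ m := le_trans (le_max_right _ _) hm
  have hm3 : 3 ≤ m := by omega
  have hm0 : (0 : ℝ) < m := by exact_mod_cast (show 0 < m by omega)
  -- `64·7! < m·η⁷`
  have hbig : 64 * (Nat.factorial 7 : ℝ) < (m : ℝ) * η ^ 7 := by
    have h1 : 64 * (Nat.factorial 7 : ℝ) / η ^ 7 < m := lt_of_lt_of_le hM₁ (by exact_mod_cast hmM)
    rwa [div_lt_iff₀ (by positivity)] at h1
  have hq : (qOf m : ℝ) ≤ 2 * ((m : ℝ) * m + 1) := by exact_mod_cast qOf_le m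
  have hq0 : (0 : ℝ) ≤ qOf m := Nat.cast_nonneg _
  have hq3 : (qOf m : ℝ) ^ 3 ≤ 64 * (m : ℝ) ^ 6 := by
    have h1 : (1 : ℝ) ≤ m := by exact_mod_cast (show 1 ≤ m by omega)
    have h4 : (qOf m : ℝ) ≤ 4 * (m : ℝ) ^ 2 := by nlinarith
    calc (qOf m : ℝ) ^ 3 ≤ (4 * (m : ℝ) ^ 2) ^ 3 := pow_le_pow_left₀ hq0 h4 3
      _ = 64 * (m : ℝ) ^ 6 := by ring
  have hk0 : (0 : ℝ) ≤ k := Nat.cast_nonneg _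
  have hN : ((2 * (k * qOf m) : ℕ) : ℝ) ≤ 4 * k * ((m : ℝ) ^ 2 + 1) := by
    push_cast
    have : (k : ℝ) * (qOf m : ℝ) ≤ k * (2 * ((m : ℝ) * m + 1)) := mul_le_mul_of_nonneg_left hq hk0
    nlinarith
  have hCB := coinBound_le_exp_mul hm11 k hN
  have hCB0 : 0 ≤ coinBound m (2 * (k * qOf m)) := by
    unfold coinBound
    exact pow_nonneg (sub_nonneg.2 (Real.rpow_le_one (cbase_nonneg hm3) (cbase_le_one hm3) (by positivity))) _
  calc (qOf m : ℝ) ^ 3 * coinBound m (2 * (k * qOf m)) ≤ 64 * (m : ℝ) ^ 6 * coinBound m (2 * (k * qOf m)) :=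
        mul_le_mul_of_nonneg_right hq3 hCB0
    _ ≤ 64 * (m : ℝ) ^ 6 * Real.exp (-((m : ℝ) * η)) := mul_le_mul_of_nonneg_left hCB (by positivity)
    _ < Real.exp ((m : ℝ) * η) * Real.exp (-((m : ℝ) * η)) :=
        mul_lt_mul_of_pos_right (numeric_lt_exp_of (by omega) hη0 hbig) (Real.exp_pos _)
    _ = 1 := by rw [← Real.exp_add, add_neg_cancel, Real.exp_zero]

/-- **`t₀(m)/q(m) → ∞`:** for every `k`, for all large `m`, no nonzero `D` of total degree `≤ k·q(m)` — of any size —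
annihilates `G_m`. [this file] -/
theorem eventually_kiPer_hits_degree_le_mul (k : ℕ) :
    ∃ M : ℕ, ∀ m : ℕ, M ≤ m → ∀ D : MvPolynomial (Fin 3 → Fin (qOf m)) ℂ, D ≠ 0 →
      D.totalDegree ≤ k * qOf m → MvPolynomial.bind₁ (kiPer m) D ≠ 0 := by
  obtain ⟨M, hM⟩ := eventually_q_cube_mul_coinBound_lt_one k
  refine ⟨max M 3, fun m hm D hD hdeg => ?_⟩
  exact kiPer_hits_of_refined (le_trans (le_max_right _ _) hm) (hM m (le_trans (le_max_left _ _) hm)) D hD hdeg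

/-- Pointwise: for all large `m`, every annihilator of `G_m` has total degree `> k·q(m)`. [this file] -/
theorem eventually_mul_q_lt_totalDegree (k : ℕ) :
    ∃ M : ℕ, ∀ m : ℕ, M ≤ m → ∀ D : MvPolynomial (Fin 3 → Fin (qOf m)) ℂ, D ≠ 0 →
      MvPolynomial.bind₁ (kiPer m) D = 0 → k * qOf m < D.totalDegree := by
  obtain ⟨M, hM⟩ := eventually_kiPer_hits_degree_le_mul k
  refine ⟨M, fun m hm D hD hann => ?_⟩
  by_contra h
  exact hM m hm D hD (not_lt.1 h) hann

/-- **Width of annihilator monomials is not `O(q)`:** for every `k`, for all large `m`, every monomial of every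
annihilator of `G_m` involves more than `k·q(m)` distinct variables. [this file] -/
theorem eventually_mul_q_lt_card_support (k : ℕ) :
    ∃ M : ℕ, ∀ m : ℕ, M ≤ m → ∀ D : MvPolynomial (Fin 3 → Fin (qOf m)) ℂ,
      MvPolynomial.bind₁ (kiPer m) D = 0 → ∀ κ₀ ∈ D.support, k * qOf m < κ₀.support.card := by
  obtain ⟨M, hM⟩ := eventually_q_cube_mul_coinBound_lt_one k
  refine ⟨max M 3, fun m hm D hann κ₀ hκ₀ => ?_⟩
  have hm3 : 3 ≤ m := le_trans (le_max_right _ _) hm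
  by_contra h
  have hle : κ₀.support.card ≤ k * qOf m := not_lt.1 h
  have hcount : (qOf m : ℝ) ^ 3 * coinBound m (2 * κ₀.support.card) < 1 :=
    lt_of_le_of_lt (mul_le_mul_of_nonneg_left (coinBound_mono hm3 (Nat.mul_le_mul_left 2 hle)) (by positivity))
      (hM m (le_trans (le_max_left _ _) hm))
  obtain ⟨π, hπ⟩ := exists_starFree_refined hm3 κ₀ hcount
  exact kiPer_hits_of_starFree D hκ₀ hπ hann

end Summit.ValiantsHypothesis.ValiantsHypothesis.Theorems.DefinabilityGapDegreeRoadOmega
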